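import Summits.BirchSwinnertonDyer.BirchSwinnertonDyer.Theorems.SchneiderFreeAdditiveX3JointLowerIdentity
import Summits.BirchSwinnertonDyer.BirchSwinnertonDyer.Theorems.SchneiderFreeAdditiveX3HeegnerTwistEqualities
import Literature.NumberTheory.EllipticCurves.Wuthrich2014.ShaBoundProofs
import HarnessLib

/-!
# Route `SchneiderFreeAdditiveX3` (K1 door): the index-trivial regime IS the joint `Ш_an`-unit window —
# `2·ord_p[E(K):ℤP] = ord_p #Ш_an(E) + ord_p #Ш_an(E^{(d_K)}) + 2·ord_p ∏_ℓ c_ℓ(E) + 2·v_p(c)` at every door datum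
# (Gross–Zagier bookkeeping, every odd `p`), so (IDX) ⟺ `ord_p(#Ш_an(E)·#Ш_an(E^{(d_K)})) ≤ 0`

Cell `bsd-schneider-ideate`, seat `bsd-schneider-door-c5` (prover, generation 38; `--supports
stmt-BirchSwinnertonDyer-19177 --as helper`).  Sequel of `…LeafIndexRegime.lean` (F32: the rung leaf's body at a pair
from `PrintedFacts` + ONE Heegner datum with (IDX) `ord_p[E(K):ℤP] ≤ ord_p ∏_ℓ c_ℓ(E) + v_p(Dt.c)`).  HONEST DICTIONARY:
what does (IDX) mean?  The route's Manin-robust Gross–Zagier identity (door-c5, `exists_shaAn_padicVal_eq_of_heegner_manin`: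
GZ I.(6.3) with the parametrisation constant kept, `L(E/K,s) = L(E,s)·L(E^{(d_K)},s)`, the period/Tamagawa transports
(eq:tamK) and `v_p(u) = 0` at odd `p`, GZ I.(7.3) for the twist's algebraic central value, Miller's
`#Ш_an(E^{(d_K)}) = q_d·#E^{(d_K)}(ℚ)²/∏c`) says, at EVERY door datum and every odd `p`,

  `2·ord_p[E(K):ℤP] = ord_p #Ш_an(E) + ord_p #Ш_an(E^{(d_K)}) + 2·ord_p ∏_ℓ c_ℓ(E) + 2·v_p(Dt.c)`     (§1)

(both analytic orders are RATIONAL here: rank one by GZ I.(7.3), rank zero by the central-value rationality).  Hence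

  (IDX) ⟺ `ord_p #Ш_an(E) + ord_p #Ш_an(E^{(d_K)}) ≤ 0`                                                (§2)

— the index-trivial regime of F32 is EXACTLY the JOINT `Ш_an`-UNIT WINDOW of the pair and its Heegner twist.  With the
partner's upper half (`PartnerUpperRankZero`, item 19181, PROVED on `PrintedFacts`: `0 ≤ ord_p #Ш(E^{(d_K)}) ≤
ord_p #Ш_an(E^{(d_K)})`) it splits (§3): (IDX) ⟹ `ord_p #Ш_an(E) ≤ 0` (cell bsd-addord's «`Ш_an`-unit window», where the
lower half is free by `N10.missingLowerBoundAt_of_padicValRat_le_zero`), and conversely `ord_p #Ш_an(E) ≤ 0` together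
with a Heegner field `K` of the door whose twist has `ord_p #Ш_an(E^{(d_K)}) = 0` (the wing's TWIST-UNIT datum, P2
census g13: available at 7 101 / 7 101 door pairs) gives (IDX).  CONSEQUENCE FOR THE RECORD: the K1 door's preprint
input [DIV.dvd] (Keller–Yin Thm. 3.3.6 ∘ Prop. 3.4.4) is load-bearing for the LOWER leaf at a census pair only on the
CONTENT WINDOW `p ∣ #Ш_an(E)` (where `Ш(E)[p] ≠ 0` is predicted and the leaf says something); F32's certificate is
nothing more — and nothing less — than an INDEX-currency witness of the window (an algebraic integer, certifiable by
exact arithmetic on the Heegner point, equivalently by the Gross–Zagier value).  Census: kit j336347 («idxcert»).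

* §1 `exists_shaAn_two_mul_padicValNat_index_eq` — the identity (§1) with the two rationals produced.
* §2 `padicValNat_index_le_iff_jointShaAnWindow` — (IDX) ⟺ joint window (uniqueness of the rational values).
* §3 `shaAn_padicValRat_le_zero_of_indexLe` ((IDX) ⟹ `ord_p #Ш_an(E) ≤ 0`, with `PartnerUpperRankZero`);
  `indexLe_of_shaAn_window_of_twistUnit` (window ∧ twist-unit ⟹ (IDX)).

HONEST FRAMING.  CONDITIONAL on the displayed published facts (conjuncts of `PrintedFacts`, item 19184); nothing asserted
about any curve; no item closes; BSD is proved for no curve.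
References: Gross–Zagier 1986 I.(6.3), I.(7.3) [GrossZagier1986]; Jetchev–Skinner–Wan 2017 §7.3.1 (eq:tamK), §7.4.1
[JetchevSkinnerWan2017]; Miller 2011 Def. 1.1, Thm. 4.1 [Miller2011LMS]; Wuthrich 2014 [Wuthrich2014]; this route's
`…JointLowerIdentity` / `…HeegnerTwistEqualities` / `…PotMultBranchIMCOfLowerHalves` (door-c5 g2–g3, door-c2 g11).
-/

set_option autoImplicit false
-- `Summit.<P>.<Sub>` repeats `BirchSwinnertonDyer` by the tree's layout convention (D-0017)
set_option linter.dupNamespace false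

noncomputable section

open scoped Classical

open WeierstrassCurve NumberField IsDedekindDomain Field
  Literature.NumberTheory.EllipticCurves
  Literature.NumberTheory.EllipticCurves.ModularForms
  Literature.NumberTheory.EllipticCurves.Rank1Residual
  Literature.NumberTheory.EllipticCurves.Rank1Residual.Typed
  Summit.BirchSwinnertonDyer.Rank1Residual
  Summit.BirchSwinnertonDyer.Rank1Residual.X11b
  Summit.BirchSwinnertonDyer.BirchSwinnertonDyer.Theorems.SchneiderFree

namespace Summit.BirchSwinnertonDyer.BirchSwinnertonDyer.Theorems.SchneiderFreeAdditiveX3.LeafIndexRegime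

section Pointwise

variable (W : WeierstrassCurve ℚ) [W.IsElliptic] [W.IsGloballyMinimal] (p : ℕ) [Fact p.Prime]
  (N : ℕ) [NeZero N] (K : Type) [Field K] [NumberField K]
  (Dt : ModularParametrizationData W N) (H : HeegnerDatum N (NumberField.discr K)) (ι : K →+* ℂ)
  (P : (W.baseChange K).toAffine.Point)

/-! ### §1 The identity -/

/-- **`2·ord_p[E(K):ℤP] = ord_p #Ш_an(E) + ord_p #Ш_an(E^{(d_K)}) + 2·ord_p ∏_ℓ c_ℓ(E) + 2·v_p(c)` at a door datum,
every odd `p`.**  Data: `W/ℚ` globally minimal of analytic rank `1`, `K` imaginary quadratic with odd `d_K`,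
`p ∤ #𝓞_K^×`, the Heegner hypothesis for `N = N_W`, `L(E^{(d_K)},1) ≠ 0`, a parametrisation datum `Dt` (constant `c`)
with Heegner point `P`, ANY globally minimal model `Wd` of the twist; published inputs GZ I.(6.3) `hGZ`, Kolyvagin
`hKo`, GZK `hGZK`, modularity `hmod`, GZ I.(7.3) `hGZ73`.  The two analytic orders are produced as rationals.
Proof: the route's Manin-robust identity `exists_shaAn_padicVal_eq_of_heegner_manin` (in terms of the twist's central
value `q_d`), Miller/Wuthrich `#Ш_an(E^{(d_K)}) = q_d·#E^{(d_K)}(ℚ)²/∏c(E^{(d_K)})`, and the odd-`p` transports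
`ord_p ∏c(E^{(d_K)}) = ord_p ∏c(E)`, `v_p(u) = 0`.
[cite: GrossZagier1986, Thm. I.(6.3) and Thm. I.(7.3)] [cite: JetchevSkinnerWan2017, §7.3.1 (eq:tamK), §7.4.1 (arXiv:1512.06894 pp. 29–31)]
[cite: Miller2011LMS, Def. 1.1] -/
theorem exists_shaAn_two_mul_padicValNat_index_eq
    (hGZ : gross_zagier N W K) (hKo : kolyvagin N W K)
    (hGZK : rank_eq_analyticRank_of_analyticRank_le_one) (hmod : hasEntireLFunction_rat)
    (hGZ73 : GrossZagier1986_thm_I_7_3)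
    (hr : W.analyticRank = 1) (hN : W.conductorNorm ℤ = N) (hK : IsImaginaryQuadratic K)
    (hodd : Odd (NumberField.discr K)) (hμ : ¬ p ∣ Units.torsionOrder K)
    (hHN : SatisfiesHeegnerHypothesis N K)
    (hLt : (W.quadraticTwist (NumberField.discr K : ℚ)).entireLFunction 1 ≠ 0)
    (hP : WeierstrassCurve.Affine.Point.map ι.toRatAlgHom P = heegnerPointComplex Dt H)
    (Wd : WeierstrassCurve ℚ) [Wd.IsElliptic] [Wd.IsGloballyMinimal] (Cd : VariableChange ℚ)
    (hWd : Cd • W.quadraticTwist (NumberField.discr K : ℚ) = Wd) (hp2 : p ≠ 2) :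
    ∃ q qd : ℚ, shaAn W = (q : ℂ) ∧ shaAn Wd = (qd : ℂ) ∧
      2 * (padicValNat p (AddSubgroup.zmultiples P).index : ℤ) =
        padicValRat p q + padicValRat p qd + 2 * padicValNat p W.tamagawaProduct +
          2 * padicValNat p Dt.c.natAbs := by
  -- the twist's algebraic central value (Gross–Zagier I.(7.3))
  obtain ⟨qd, hqd⟩ := exists_rat_twist_L_one_div_realPeriod_of_heegner W N K Dt H ι P
    hGZ hKo hGZK hmod hGZ73 hK hHN hP hr hLt Wd Cd hWd
  -- the Manin-robust bookkeeping identity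
  obtain ⟨-, -, -, q, hq, hval⟩ := exists_shaAn_padicVal_eq_of_heegner_manin W p N K
    Dt H ι P hGZ hKo hGZK hmod hK hHN hP hp2 hμ hr hLt Wd Cd hWd qd hqd
  -- `#Ш_an(E^{d_K})` in rank zero
  have hD0 : (NumberField.discr K : ℚ) ≠ 0 := by exact_mod_cast NumberField.discr_ne_zero K
  haveI : (W.quadraticTwist (NumberField.discr K : ℚ)).IsElliptic := W.isElliptic_quadraticTwist hD0
  have hLd1 : Wd.entireLFunction 1 ≠ 0 := by rw [← hWd, entireLFunction_smul]; exact hLt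
  obtain ⟨-, hfin, -, hshaAnd⟩ := Wuthrich2014.shaAn_eq_of_L_one_div_eq hGZK Wd hLd1 hqd
  haveI := hfin
  have htdeq : Wd.torsionOrder = Nat.card Wd.toAffine.Point := Wd.torsionOrder_eq_natCard_of_finite
  -- the two transports, as EQUALITIES at every odd `p`
  have hHN' : SatisfiesHeegnerHypothesis (W.conductorNorm ℤ) K := by rw [hN]; exact hHN
  have htam := padicValNat_tamagawaProduct_twist_eq_of_heegner_odd W p hp2 K hK hodd hHN' Cd hWd
  have hu := padicValRat_u_eq_zero_of_twist_minimal_of_heegner_odd W p hp2 K hK hodd hHN' Cd hWd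
  -- the rational `#Ш_an(E^{d_K})` and its valuation
  set qd' : ℚ := qd * (Nat.card Wd.toAffine.Point : ℚ) ^ 2 / (Wd.tamagawaProduct : ℚ) with hqd'_def
  have hqd0 : qd ≠ 0 := by
    intro h0
    apply hLd1
    have hΩ : (Wd.realPeriodRat : ℂ) ≠ 0 := by exact_mod_cast Wd.realPeriodRat_pos_holds.ne'
    rw [h0, Rat.cast_zero, div_eq_zero_iff] at hqd
    exact hqd.resolve_right hΩ
  have htd0 : (Nat.card Wd.toAffine.Point : ℚ) ≠ 0 := by exact_mod_cast (Nat.card_pos).ne'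
  have hcd0 : (Wd.tamagawaProduct : ℚ) ≠ 0 := by exact_mod_cast Wd.tamagawaProduct_pos_holds.ne'
  have hvd : padicValRat p qd' =
      padicValRat p qd + 2 * padicValNat p Wd.torsionOrder - padicValNat p Wd.tamagawaProduct := by
    rw [hqd'_def, padicValRat.div (mul_ne_zero hqd0 (pow_ne_zero _ htd0)) hcd0,
      padicValRat.mul hqd0 (pow_ne_zero _ htd0), padicValRat.pow, padicValRat.of_nat, padicValRat.of_nat,
      htdeq]
    push_cast; ring
  refine ⟨q, qd', hq, by rw [hshaAnd], ?_⟩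
  have e3 : (padicValNat p Wd.tamagawaProduct : ℤ) = padicValNat p W.tamagawaProduct := by
    exact_mod_cast htam
  rw [hvd]
  linarith

/-! ### §2 (IDX) ⟺ the joint `Ш_an`-unit window -/

/-- **(IDX) ⟺ `ord_p #Ш_an(E) + ord_p #Ш_an(E^{(d_K)}) ≤ 0`** at a door datum, every odd `p`: the index-trivial
regime of `…LeafIndexRegime` is EXACTLY the joint `Ш_an`-unit window of the pair and its Heegner twist (the window is
stated as «for all rational values», equivalently «for the rational values», which exist and are unique by §1).  Same
binders as `exists_shaAn_two_mul_padicValNat_index_eq`. [cite: GrossZagier1986, Thm. I.(6.3) and Thm. I.(7.3)]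
[cite: Miller2011LMS, Def. 1.1 and Thm. 4.1] -/
theorem padicValNat_index_le_iff_jointShaAnWindow
    (hGZ : gross_zagier N W K) (hKo : kolyvagin N W K)
    (hGZK : rank_eq_analyticRank_of_analyticRank_le_one) (hmod : hasEntireLFunction_rat)
    (hGZ73 : GrossZagier1986_thm_I_7_3)
    (hr : W.analyticRank = 1) (hN : W.conductorNorm ℤ = N) (hK : IsImaginaryQuadratic K)
    (hodd : Odd (NumberField.discr K)) (hμ : ¬ p ∣ Units.torsionOrder K)
    (hHN : SatisfiesHeegnerHypothesis N K)
    (hLt : (W.quadraticTwist (NumberField.discr K : ℚ)).entireLFunction 1 ≠ 0)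
    (hP : WeierstrassCurve.Affine.Point.map ι.toRatAlgHom P = heegnerPointComplex Dt H)
    (Wd : WeierstrassCurve ℚ) [Wd.IsElliptic] [Wd.IsGloballyMinimal] (Cd : VariableChange ℚ)
    (hWd : Cd • W.quadraticTwist (NumberField.discr K : ℚ) = Wd) (hp2 : p ≠ 2) :
    padicValNat p (AddSubgroup.zmultiples P).index ≤ padicValNat p W.tamagawaProduct + padicValNat p Dt.c.natAbs ↔
      ∀ q qd : ℚ, shaAn W = (q : ℂ) → shaAn Wd = (qd : ℂ) → padicValRat p q + padicValRat p qd ≤ 0 := by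
  obtain ⟨q, qd, hq, hqd, hid⟩ := exists_shaAn_two_mul_padicValNat_index_eq W p N K Dt H ι P hGZ hKo hGZK hmod hGZ73
    hr hN hK hodd hμ hHN hLt hP Wd Cd hWd hp2
  constructor
  · intro hidx q' qd' hq' hqd'
    have hqq : q' = q := by exact_mod_cast hq'.symm.trans hq
    have hdd : qd' = qd := by exact_mod_cast hqd'.symm.trans hqd
    subst hqq hdd
    have hidx' : (padicValNat p (AddSubgroup.zmultiples P).index : ℤ) ≤
        padicValNat p W.tamagawaProduct + padicValNat p Dt.c.natAbs := by exact_mod_cast hidx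
    linarith
  · intro hwin
    have h := hwin q qd hq hqd
    have : (padicValNat p (AddSubgroup.zmultiples P).index : ℤ) ≤
        padicValNat p W.tamagawaProduct + padicValNat p Dt.c.natAbs := by linarith
    exact_mod_cast this

/-! ### §3 The two halves of the window -/

/-- **(IDX) ⟹ `ord_p #Ш_an(E) ≤ 0`** (cell bsd-addord's `Ш_an`-unit window of the curve itself) at a door datum,
every odd `p`, GIVEN the partner's upper half `ord_p #Ш(E^{(d_K)}) ≤ ord_p #Ш_an(E^{(d_K)})` (item `PartnerUpperRankZero`,
PROVED on `PrintedFacts`; passed as the hypothesis `hUd` at the twist so that this lemma stays pointwise).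
[cite: GrossZagier1986, Thm. I.(6.3)] [cite: Miller2011LMS, Def. 1.1] -/
theorem shaAn_padicValRat_le_zero_of_indexLe
    (hGZ : gross_zagier N W K) (hKo : kolyvagin N W K)
    (hGZK : rank_eq_analyticRank_of_analyticRank_le_one) (hmod : hasEntireLFunction_rat)
    (hGZ73 : GrossZagier1986_thm_I_7_3)
    (hr : W.analyticRank = 1) (hN : W.conductorNorm ℤ = N) (hK : IsImaginaryQuadratic K)
    (hodd : Odd (NumberField.discr K)) (hμ : ¬ p ∣ Units.torsionOrder K)
    (hHN : SatisfiesHeegnerHypothesis N K)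
    (hLt : (W.quadraticTwist (NumberField.discr K : ℚ)).entireLFunction 1 ≠ 0)
    (hP : WeierstrassCurve.Affine.Point.map ι.toRatAlgHom P = heegnerPointComplex Dt H)
    (Wd : WeierstrassCurve ℚ) [Wd.IsElliptic] [Wd.IsGloballyMinimal] (Cd : VariableChange ℚ)
    (hWd : Cd • W.quadraticTwist (NumberField.discr K : ℚ) = Wd) (hp2 : p ≠ 2)
    (hUd : MissingUpperBoundAt Wd p)
    (hidx : padicValNat p (AddSubgroup.zmultiples P).index ≤
      padicValNat p W.tamagawaProduct + padicValNat p Dt.c.natAbs) :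
    ∃ q : ℚ, shaAn W = (q : ℂ) ∧ padicValRat p q ≤ 0 := by
  obtain ⟨q, qd, hq, hqd, hid⟩ := exists_shaAn_two_mul_padicValNat_index_eq W p N K Dt H ι P hGZ hKo hGZK hmod hGZ73
    hr hN hK hodd hμ hHN hLt hP Wd Cd hWd hp2
  obtain ⟨qd', hqd', hud⟩ := hUd
  have hdd : qd' = qd := by exact_mod_cast hqd'.symm.trans hqd
  subst hdd
  refine ⟨q, hq, ?_⟩
  have hidx' : (padicValNat p (AddSubgroup.zmultiples P).index : ℤ) ≤
      padicValNat p W.tamagawaProduct + padicValNat p Dt.c.natAbs := by exact_mod_cast hidx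
  have h0 : (0 : ℤ) ≤ (padicValNat p Wd.shaOrder : ℤ) := by positivity
  linarith

/-- **`ord_p #Ш_an(E) ≤ 0` ∧ `ord_p #Ш_an(E^{(d_K)}) ≤ 0` ⟹ (IDX)** at a door datum, every odd `p`: the curve's own
`Ш_an`-unit window together with a TWIST-UNIT Heegner field (the wing's datum `TU`) put the pair in the index-trivial
regime of `…LeafIndexRegime`. [cite: GrossZagier1986, Thm. I.(6.3)] [cite: Miller2011LMS, Def. 1.1] -/
theorem indexLe_of_shaAn_window_of_twistUnit
    (hGZ : gross_zagier N W K) (hKo : kolyvagin N W K)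
    (hGZK : rank_eq_analyticRank_of_analyticRank_le_one) (hmod : hasEntireLFunction_rat)
    (hGZ73 : GrossZagier1986_thm_I_7_3)
    (hr : W.analyticRank = 1) (hN : W.conductorNorm ℤ = N) (hK : IsImaginaryQuadratic K)
    (hodd : Odd (NumberField.discr K)) (hμ : ¬ p ∣ Units.torsionOrder K)
    (hHN : SatisfiesHeegnerHypothesis N K)
    (hLt : (W.quadraticTwist (NumberField.discr K : ℚ)).entireLFunction 1 ≠ 0)
    (hP : WeierstrassCurve.Affine.Point.map ι.toRatAlgHom P = heegnerPointComplex Dt H)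
    (Wd : WeierstrassCurve ℚ) [Wd.IsElliptic] [Wd.IsGloballyMinimal] (Cd : VariableChange ℚ)
    (hWd : Cd • W.quadraticTwist (NumberField.discr K : ℚ) = Wd) (hp2 : p ≠ 2)
    {q qd : ℚ} (hq : shaAn W = (q : ℂ)) (hqd : shaAn Wd = (qd : ℂ)) (hwq : padicValRat p q ≤ 0)
    (hwd : padicValRat p qd ≤ 0) :
    padicValNat p (AddSubgroup.zmultiples P).index ≤ padicValNat p W.tamagawaProduct + padicValNat p Dt.c.natAbs := by
  refine (padicValNat_index_le_iff_jointShaAnWindow W p N K Dt H ι P hGZ hKo hGZK hmod hGZ73 hr hN hK hodd hμ hHN hLt hP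
    Wd Cd hWd hp2).2 fun q' qd' hq' hqd' ↦ ?_
  have hqq : q' = q := by exact_mod_cast hq'.symm.trans hq
  have hdd : qd' = qd := by exact_mod_cast hqd'.symm.trans hqd
  subst hqq hdd
  linarith

end Pointwise

end Summit.BirchSwinnertonDyer.BirchSwinnertonDyer.Theorems.SchneiderFreeAdditiveX3.LeafIndexRegime

end
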